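import Summits.BirchSwinnertonDyer.BirchSwinnertonDyer.Theorems.PrintCf2SplitBadTwoCMShaEigenMiddleFactorH1
import HarnessLib

/-!
# Crux `PrintCf2.SplitBadTwoRankOneOfFacts` (item stmt-BirchSwinnertonDyer-20368), road α, S3c₂ bottom value: factor (F2) and (H1′) modulo the
# CM input AT SELMER CLASSES ONLY — (H1-Sel) «the `E[𝔮_r^∞]`-component of a SELMER class dies on `D_v`»

Cell `bsd-print-cf2`, width seat `bsd-line-cf2-p1-w8` g2 (brick **B6h**); `--supports stmt-BirchSwinnertonDyer-20368` (helper, Theses-free).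
HONEST FRAMING: nothing here closes a crux or a stub; BSD is not proved by any of this; no summit statement is proved by this seat. No
definition, no named fact, no `sorry`. beyond-print theorem: no.

WHY. p669645 / p671611 reduce (F2) and (H1′) of (R-BV) to (H1″) `ι_*⁻¹(localKerOver p ⊤ K_v) ≤ ker res_{⊤ ⊓ D_v}` — a statement about ALL
classes of `H¹(K, E[𝔮_r^∞])` classical at `v`, which only LOCAL arithmetic (formal group, (H1-pts), p670747) can supply. But the proofs use it
only at the `E[𝔮_r^∞]`-components of SELMER classes. This file records the weaker, purely GLOBAL-facing input
  (H1-Sel) `∀ y₀ ∈ Sel_{p^∞}(E_K/K), ∀ c c′, ι_* c + ι′_* c′ = res_⊤ y₀ → res_{⊤ ⊓ D_v} c = 0`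
(no projector data; `c` is forced to be the `E[𝔮_r^∞]`-component), which is ALSO what -w3 g9's dichotomy-and-exclusion route
(`KummerBranchDichotomy`, p671916: decide the branch by the finiteness of the conjugate restricted Selmer group) can deliver for
`Q = res_⊤(Sel_{p^∞})` without any formal-group input. So (F2) ∧ (H1′) ⟸ (H1-Sel), and (H1-Sel) ⟸ (H1″) ⟸ (H1-pts).

* §1 (ns `RestrictedSelmerPair`, -w7 g2's currency) `proj_resSubgroup_mem_trueSelmer_of_sel`, `mem_range_shaMap_trueSelmer_of_eigen_of_sel`
  — -w7 g2's p667915 / p668690 with (H1″) weakened to (H1-Sel) (same proofs; (H1″) was applied to `ι_* e_* res_⊤ y₀` only).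
* §2 (ns `CMPrimes`) `natCard_range_shaBridge_trueSelmer_eq_of_sel` (`#f(𝔖_v ⊓ L_M) = #C` ⟸ (H1-Sel)), `comap_kummer_le_ker_resOfLe_of_sel`
  ((H1′) ⟸ (H1-Sel): Kummer classes are Selmer; take `c′ = 0`), `sel_input_of_H1` ((H1-Sel) ⟸ (H1″), so nothing is lost).

References: A. Agboola, Compositio 143 (2007) §6 [Agboola2007]; K. Rubin, LNM 1716 (1999) §2 [Rubin1999]; R. Greenberg, LNM 1716 (1999) §2
[GreenbergLNM1716].
-/

noncomputable section

open scoped Classical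

set_option linter.dupNamespace false
set_option autoImplicit false

open NumberField IsDedekindDomain Field WeierstrassCurve
open Literature.NumberTheory.EllipticCurves Literature.NumberTheory.EllipticCurves.GreenbergSelmer
open Literature.NumberTheory.EllipticCurves.Castella2018.AcSelmer
open Literature.NumberTheory.EllipticCurves.Agboola2007
open Literature.NumberTheory.EllipticCurves.ResKernel
open Literature.NumberTheory.GaloisRepresentations

universe u

/-! ## §1 -w7 g2's Selmer-to-true-Selmer and assembly, with (H1″) weakened to (H1-Sel) -/

namespace Summit.BirchSwinnertonDyer.BirchSwinnertonDyer.Theorems.PrintCf2.RestrictedSelmerPair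

section SelVariant

variable {K : Type u} [Field K] [NumberField K] (V : WeierstrassCurve K) [V.IsElliptic] (p : ℕ) [Fact p.Prime]
  (π : V.endRing) (r r' : ℤ_[p])
  (f₀ : V.geomPoints →+ V.geomPoints) (hf₀ : ∀ (σ : absoluteGaloisGroup K) (P : V.geomPoints), f₀ (σ • P) = σ • f₀ P)
  (hfr : ∀ (k : ℕ) (N : ℤ) (x : V.geomPrimaryTorsion p), x ∈ V.endEigenPrimaryTorsion p π r → p ^ k • x = 0 →
    ((N : ℤ_[p]) - r) ∈ (Ideal.span {(p : ℤ_[p]) ^ k} : Ideal ℤ_[p]) → f₀ (x : V.geomPoints) = N • (x : V.geomPoints))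
  (hfr' : ∀ (k : ℕ) (N : ℤ) (x : V.geomPrimaryTorsion p), x ∈ V.endEigenPrimaryTorsion p π r' → p ^ k • x = 0 →
    ((N : ℤ_[p]) - r') ∈ (Ideal.span {(p : ℤ_[p]) ^ k} : Ideal ℤ_[p]) → f₀ (x : V.geomPoints) = N • (x : V.geomPoints))
  (hunit : IsUnit (r - r')) (hloc : HasLocalPointsMaps V V f₀)
  (e : V.geomPrimaryTorsion p →+ ↥(V.endEigenPrimaryTorsion p π r))
  (e' : V.geomPrimaryTorsion p →+ ↥(V.endEigenPrimaryTorsion p π r'))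
  (he : ∀ (σ : absoluteGaloisGroup K) (x : V.geomPrimaryTorsion p), e (σ • x) = σ • e x)
  (he' : ∀ (σ : absoluteGaloisGroup K) (x : V.geomPrimaryTorsion p), e' (σ • x) = σ • e' x)
  (hsum : ∀ x, (e x : V.geomPrimaryTorsion p) + (e' x : V.geomPrimaryTorsion p) = x)
  (v vbar : HeightOneSpectrum (𝓞 K))

include hf₀ hfr hfr' hunit hloc he' hsum in
/-- **The `M_r`-component of a Selmer class lies in the summand's true Selmer group `𝔖_v(K, M_r) ⊓ L_{M_r}`, GRANTED (H1-Sel)** — -w7 g2's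
`proj_resSubgroup_mem_trueSelmer` (p667915) with the CM input required at Selmer classes only. [cite: Agboola2007, §3, §6] -/
theorem proj_resSubgroup_mem_trueSelmer_of_sel (hK : IsImaginaryQuadratic K)
    (hinf : V.endEigenPrimaryTorsion p π r ⊓ V.endEigenPrimaryTorsion p π r' = ⊥)
    (hsup : V.endEigenPrimaryTorsion p π r ⊔ V.endEigenPrimaryTorsion p π r' = ⊤)
    (hSel : ∀ y₀ ∈ V.selmerGroupPInfty p,
      ∀ (c : subgroupH1 (⊤ : Subgroup (absoluteGaloisGroup K)) ↥(V.endEigenPrimaryTorsion p π r))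
        (c' : subgroupH1 (⊤ : Subgroup (absoluteGaloisGroup K)) ↥(V.endEigenPrimaryTorsion p π r')),
        resH1Hom (ContinuousMonoidHom.id _) (V.endEigenPrimaryTorsion p π r).subtype (fun _ _ ↦ rfl) c +
            resH1Hom (ContinuousMonoidHom.id _) (V.endEigenPrimaryTorsion p π r').subtype (fun _ _ ↦ rfl) c' =
          resSubgroup (⊤ : Subgroup (absoluteGaloisGroup K)) (V.geomPrimaryTorsion p) y₀ →
        Literature.NumberTheory.EllipticCurves.resOfLe ↥(V.endEigenPrimaryTorsion p π r) (inf_le_left : ⊤ ⊓ decomp v ≤ ⊤) c = 0)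
    {y₀ : galH1Primary V p} (hy₀ : y₀ ∈ V.selmerGroupPInfty p) :
    resH1Hom (ContinuousMonoidHom.id _) e (fun σ x ↦ by rw [Subgroup.smul_def, Subgroup.smul_def]; exact he σ x)
        (resSubgroup (⊤ : Subgroup (absoluteGaloisGroup K)) (V.geomPrimaryTorsion p) y₀) ∈
      restrictedSelmerBase ↥(V.endEigenPrimaryTorsion p π r) p v ⊓
        (V.localKerOver p ⊤ (vbar.adicCompletion K)).comap
          (resH1Hom (ContinuousMonoidHom.id _) (V.endEigenPrimaryTorsion p π r).subtype (fun _ _ ↦ rfl)) := by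
  set c := resH1Hom (ContinuousMonoidHom.id _) e (fun σ x ↦ by rw [Subgroup.smul_def, Subgroup.smul_def]; exact he σ x)
    (resSubgroup (⊤ : Subgroup (absoluteGaloisGroup K)) (V.geomPrimaryTorsion p) y₀) with hcdef
  have hsel := resH1Hom_subtype_proj_mem_map_resSubgroup_selmer V p π r r' f₀ hf₀ hfr hfr' hunit hloc e e' he he' hsum hy₀
  -- `ι_* c` satisfies the classical condition at every finite completion
  have hclass : ∀ w : HeightOneSpectrum (𝓞 K),
      resH1Hom (ContinuousMonoidHom.id _) (V.endEigenPrimaryTorsion p π r).subtype (fun _ _ ↦ rfl) c ∈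
        V.localKerOver p ⊤ (w.adicCompletion K) := by
    intro w
    obtain ⟨z, hz, hzc⟩ := AddSubgroup.mem_map.mp hsel
    rw [← hcdef] at hzc
    rw [← hzc]
    simp only [WeierstrassCurve.selmerGroupPInfty, AddSubgroup.mem_inf, AddSubgroup.mem_iInf] at hz
    exact V.resSubgroup_top_mem_localKerOver (hz.1 w)
  refine AddSubgroup.mem_inf.mpr ⟨?_, AddSubgroup.mem_comap.mpr (hclass vbar)⟩
  rw [mem_restrictedSelmerBase_iff_resOfLe]
  refine ⟨fun w hw ↦ ?_, fun w ↦ resOfLe_decompInf_eq_zero_of_isComplex _ (hK.2.isComplex w) c, ?_⟩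
  · exact AddMonoidHom.mem_ker.mp
      (comap_localKerOver_le_ker_resOfLe_of_not_mem V p π r r' hinf hsup w hw (AddSubgroup.mem_comap.mpr (hclass w)))
  · exact hSel y₀ hy₀ c _ (resH1Hom_subtype_proj_add_eq V p π r r' ⊤ e e' he he' hsum _)

include hfr hfr' in
/-- **(⊇) under (H1-Sel)**: every `r`-eigen class of `P(Sel_{p^∞}(E_K/K))` lies in `f(𝔖_v(K, M_r) ⊓ L_{M_r})` — -w7 g2's
`mem_range_shaMap_trueSelmer_of_eigen` (p668690) with (H1″) weakened to (H1-Sel). [cite: Agboola2007, §6] [cite: Rubin1999, §2] -/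
theorem mem_range_shaMap_trueSelmer_of_eigen_of_sel (hK : IsImaginaryQuadratic K)
    (hinf : V.endEigenPrimaryTorsion p π r ⊓ V.endEigenPrimaryTorsion p π r' = ⊥)
    (hsup : V.endEigenPrimaryTorsion p π r ⊔ V.endEigenPrimaryTorsion p π r' = ⊤) (hunit : IsUnit (r - r'))
    (hloc : HasLocalPointsMaps V V f₀)
    (hSel : ∀ y₀ ∈ V.selmerGroupPInfty p,
      ∀ (c : subgroupH1 (⊤ : Subgroup (absoluteGaloisGroup K)) ↥(V.endEigenPrimaryTorsion p π r))
        (c' : subgroupH1 (⊤ : Subgroup (absoluteGaloisGroup K)) ↥(V.endEigenPrimaryTorsion p π r')),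
        resH1Hom (ContinuousMonoidHom.id _) (V.endEigenPrimaryTorsion p π r).subtype (fun _ _ ↦ rfl) c +
            resH1Hom (ContinuousMonoidHom.id _) (V.endEigenPrimaryTorsion p π r').subtype (fun _ _ ↦ rfl) c' =
          resSubgroup (⊤ : Subgroup (absoluteGaloisGroup K)) (V.geomPrimaryTorsion p) y₀ →
        Literature.NumberTheory.EllipticCurves.resOfLe ↥(V.endEigenPrimaryTorsion p π r) (inf_le_left : ⊤ ⊓ decomp v ≤ ⊤) c = 0)
    {x : V.galH1} (hxSel : x ∈ (V.selmerGroupPInfty p).map (V.primaryH1ToH1 p))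
    (hxEig : ∀ (k : ℕ) (N : ℤ), p ^ k • x = 0 → ((N : ℤ_[p]) - r) ∈ (Ideal.span {(p : ℤ_[p]) ^ k} : Ideal ℤ_[p]) →
        galH1Map f₀ hf₀ x = N • x) :
    x ∈ (((V.primaryH1ToH1 p).comp (AddEquiv.ofBijective (resSubgroup ⊤ (V.geomPrimaryTorsion p))
        (resSubgroup_top_bijective (V.geomPrimaryTorsion p))).symm.toAddMonoidHom).comp
      ((resH1Hom (ContinuousMonoidHom.id _) (V.endEigenPrimaryTorsion p π r).subtype (fun _ _ ↦ rfl)).comp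
        (restrictedSelmerBase ↥(V.endEigenPrimaryTorsion p π r) p v ⊓
            (V.localKerOver p ⊤ (vbar.adicCompletion K)).comap
              (resH1Hom (ContinuousMonoidHom.id _) (V.endEigenPrimaryTorsion p π r).subtype (fun _ _ ↦ rfl))).subtype)).range := by
  obtain ⟨y₀, hy₀, rfl⟩ := AddSubgroup.mem_map.mp hxSel
  set Re := AddEquiv.ofBijective (resSubgroup (⊤ : Subgroup (absoluteGaloisGroup K)) (V.geomPrimaryTorsion p))
    (resSubgroup_top_bijective (G := absoluteGaloisGroup K) (V.geomPrimaryTorsion p)) with hRe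
  -- the projectors
  obtain ⟨e, he₁, he₂, hesub, he⟩ := exists_eigenProjector V p π r r' hinf hsup
  obtain ⟨e', he'₁, he'₂, -, he'⟩ := exists_eigenProjector V p π r' r (by rw [inf_comm]; exact hinf) (by rw [sup_comm]; exact hsup)
  have hsum := coe_proj_add_coe_proj V p π r r' e e' hesub he'₁ he'₂
  set y := resSubgroup (⊤ : Subgroup (absoluteGaloisGroup K)) (V.geomPrimaryTorsion p) y₀ with hydef
  have hy : Re.symm.toAddMonoidHom y = y₀ := Re.symm_apply_apply y₀
  have hx' : V.primaryH1ToH1 p y₀ = ((V.primaryH1ToH1 p).comp Re.symm.toAddMonoidHom) y := by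
    rw [AddMonoidHom.comp_apply, hy]
  rw [hx'] at hxEig ⊢
  have heq := primaryH1ToH1_eq_of_eigen V p π r r' f₀ hf₀ hfr hfr' hinf hsup hunit e hesub he y hxEig
  have hmem := proj_resSubgroup_mem_trueSelmer_of_sel V p π r r' f₀ hf₀ hfr hfr' hunit hloc e e' he he' hsum v vbar hK hinf hsup
    hSel hy₀
  rw [heq]
  exact ⟨⟨_, hmem⟩, rfl⟩

end SelVariant

end Summit.BirchSwinnertonDyer.BirchSwinnertonDyer.Theorems.PrintCf2.RestrictedSelmerPair

/-! ## §2 `#f(𝔖_v ⊓ L_M) = #C` and (H1′) modulo (H1-Sel); (H1-Sel) ⟸ (H1″) -/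

namespace Summit.BirchSwinnertonDyer.BirchSwinnertonDyer.Theorems.PrintCf2.CMPrimes

open Summit.BirchSwinnertonDyer.BirchSwinnertonDyer.Theorems.PrintCf2.RestrictedSelmerPair

section Generic

variable {K : Type u} [Field K] [NumberField K] (V : WeierstrassCurve K) [V.IsElliptic] (p : ℕ) [Fact p.Prime]
  (π : V.endRing) (r : ℤ_[p]) (v vbar : HeightOneSpectrum (𝓞 K))

/-- **`#f(𝔖_v(K, E[𝔮_r^∞]) ⊓ L_M) = #C` modulo (H1-Sel)** (cf. `natCard_range_shaBridge_trueSelmer_eq_of_H1`, p669645, where the CM input was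
(H1″)). [cite: Agboola2007, Props. 6.10–6.11 (arXiv p0014:L1–p0015:L12)] [cite: Rubin1999, §2] -/
theorem natCard_range_shaBridge_trueSelmer_eq_of_sel (hK : IsImaginaryQuadratic K)
    (hall : ∀ w : HeightOneSpectrum (𝓞 K), ((p : ℕ) : 𝓞 K) ∈ w.asIdeal → w = v ∨ w = vbar)
    (hinf : V.endEigenPrimaryTorsion p π r ⊓ V.endEigenPrimaryTorsion p π (1 - r) = ⊥)
    (hsup : V.endEigenPrimaryTorsion p π r ⊔ V.endEigenPrimaryTorsion p π (1 - r) = ⊤) (hunit : IsUnit (r - (1 - r)))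
    (φ : WeierstrassCurve.Isogeny V V) (hφ : ∀ P, φ P = (π : AddMonoid.End V.geomPoints) P)
    (hSel : ∀ y₀ ∈ V.selmerGroupPInfty p,
      ∀ (c : subgroupH1 (⊤ : Subgroup (absoluteGaloisGroup K)) ↥(V.endEigenPrimaryTorsion p π r))
        (c' : subgroupH1 (⊤ : Subgroup (absoluteGaloisGroup K)) ↥(V.endEigenPrimaryTorsion p π (1 - r))),
        resH1Hom (ContinuousMonoidHom.id _) (V.endEigenPrimaryTorsion p π r).subtype (fun _ _ ↦ rfl) c +
            resH1Hom (ContinuousMonoidHom.id _) (V.endEigenPrimaryTorsion p π (1 - r)).subtype (fun _ _ ↦ rfl) c' =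
          resSubgroup (⊤ : Subgroup (absoluteGaloisGroup K)) (V.geomPrimaryTorsion p) y₀ →
        Literature.NumberTheory.EllipticCurves.resOfLe ↥(V.endEigenPrimaryTorsion p π r) (inf_le_left : ⊤ ⊓ decomp v ≤ ⊤) c = 0)
    {C : AddSubgroup (AddCommGroup.primaryComponent V.sha p)}
    (hC : ∀ x, x ∈ C ↔ ∀ (k : ℕ) (N : ℤ), p ^ k • x = 0 →
      ((N : ℤ_[p]) - r) ∈ (Ideal.span {(p : ℤ_[p]) ^ k} : Ideal ℤ_[p]) →
        galH1Map φ.toAddMonoidHom φ.equivariant (((x : AddCommGroup.primaryComponent V.sha p) : V.sha) : V.galH1) =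
          N • (((x : AddCommGroup.primaryComponent V.sha p) : V.sha) : V.galH1)) :
    Nat.card ↥(((V.primaryH1ToH1 p).comp (AddEquiv.ofBijective (resSubgroup (⊤ : Subgroup (absoluteGaloisGroup K)) ↥(V.geomPrimaryTorsion p))
        (resSubgroup_top_bijective ↥(V.geomPrimaryTorsion p))).symm.toAddMonoidHom).comp
      ((resH1Hom (ContinuousMonoidHom.id _) (V.endEigenPrimaryTorsion p π r).subtype (fun _ _ ↦ rfl)).comp
        (restrictedSelmerBase ↥(V.endEigenPrimaryTorsion p π r) p v ⊓
            (V.localKerOver p ⊤ (vbar.adicCompletion K)).comap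
              (resH1Hom (ContinuousMonoidHom.id _) (V.endEigenPrimaryTorsion p π r).subtype (fun _ _ ↦ rfl))).subtype)).range =
      Nat.card ↥C := by
  set S := restrictedSelmerBase ↥(V.endEigenPrimaryTorsion p π r) p v ⊓
    (V.localKerOver p ⊤ (vbar.adicCompletion K)).comap
      (resH1Hom (ContinuousMonoidHom.id _) (V.endEigenPrimaryTorsion p π r).subtype (fun _ _ ↦ rfl)) with hS
  have hSsha := (natCard_trueSelmer_quotient_eq_natCard_range_shaMap V p π r v vbar hK hall).2
  obtain ⟨ε, hεinj, hεval⟩ := exists_injective_range_shaBridge_to_eigen V p π r S φ hφ hSsha hC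
  have hfr : ∀ (k : ℕ) (N : ℤ) (x : V.geomPrimaryTorsion p), x ∈ V.endEigenPrimaryTorsion p π r → p ^ k • x = 0 →
      ((N : ℤ_[p]) - r) ∈ (Ideal.span {(p : ℤ_[p]) ^ k} : Ideal ℤ_[p]) →
        φ.toAddMonoidHom (x : V.geomPoints) = N • (x : V.geomPoints) := fun k N x hx hk hN ↦ by
    rw [show φ.toAddMonoidHom (x : V.geomPoints) = φ (x : V.geomPoints) from rfl, hφ]
    exact (eigen_of_endRing V p π r).2 k N x hx hk hN
  have hfr' : ∀ (k : ℕ) (N : ℤ) (x : V.geomPrimaryTorsion p), x ∈ V.endEigenPrimaryTorsion p π (1 - r) → p ^ k • x = 0 →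
      ((N : ℤ_[p]) - (1 - r)) ∈ (Ideal.span {(p : ℤ_[p]) ^ k} : Ideal ℤ_[p]) →
        φ.toAddMonoidHom (x : V.geomPoints) = N • (x : V.geomPoints) := fun k N x hx hk hN ↦ by
    rw [show φ.toAddMonoidHom (x : V.geomPoints) = φ (x : V.geomPoints) from rfl, hφ]
    exact (eigen_of_endRing V p π (1 - r)).2 k N x hx hk hN
  refine Nat.card_congr (Equiv.ofBijective ε ⟨hεinj, fun z ↦ ?_⟩)
  have hzprim : (((z : AddCommGroup.primaryComponent V.sha p) : V.sha) : V.galH1) ∈ AddCommGroup.primaryComponent V.galH1 p := by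
    obtain ⟨n, hn⟩ := (AddCommGroup.mem_primaryComponent).mp (z : AddCommGroup.primaryComponent V.sha p).2
    refine (AddCommGroup.mem_primaryComponent).mpr ⟨n, ?_⟩
    have h := congrArg (fun y : V.sha ↦ (y : V.galH1)) hn
    simpa using h
  have hzSel : (((z : AddCommGroup.primaryComponent V.sha p) : V.sha) : V.galH1) ∈ (V.selmerGroupPInfty p).map (V.primaryH1ToH1 p) := by
    rw [V.map_primaryH1ToH1_selmerGroupPInfty_eq_sha_inf_range p]
    exact AddSubgroup.mem_inf.mpr ⟨((z : AddCommGroup.primaryComponent V.sha p) : V.sha).2,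
      WeierstrassCurve.primaryComponent_le_range_primaryH1ToH1 V p V.zsmul_geomPoints_surjective_holds hzprim⟩
  have hzEig : ∀ (k : ℕ) (N : ℤ), p ^ k • (((z : AddCommGroup.primaryComponent V.sha p) : V.sha) : V.galH1) = 0 →
      ((N : ℤ_[p]) - r) ∈ (Ideal.span {(p : ℤ_[p]) ^ k} : Ideal ℤ_[p]) →
        galH1Map φ.toAddMonoidHom φ.equivariant (((z : AddCommGroup.primaryComponent V.sha p) : V.sha) : V.galH1) =
          N • (((z : AddCommGroup.primaryComponent V.sha p) : V.sha) : V.galH1) := fun k N hk hN ↦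
    (hC z).mp z.2 k N (Subtype.ext (Subtype.ext (by simpa only [AddSubmonoidClass.coe_nsmul, ZeroMemClass.coe_zero] using hk))) hN
  have hmem := mem_range_shaMap_trueSelmer_of_eigen_of_sel V p π r (1 - r) φ.toAddMonoidHom φ.equivariant hfr hfr' v vbar hK hinf hsup
    hunit φ.hasLocalPointsMaps_toAddMonoidHom hSel hzSel hzEig
  obtain ⟨⟨c, hc⟩, hcz⟩ := hmem
  refine ⟨⟨_, ⟨⟨c, hc⟩, rfl⟩⟩, ?_⟩
  apply Subtype.ext; apply Subtype.ext; apply Subtype.ext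
  rw [hεval]
  exact hcz

/-- **(H1′) ⟸ (H1-Sel)**: the canonical Kummer subgroup `Q_M = ι_*⁻¹(res_⊤(range κ))` is strict at `v` — Kummer classes are Selmer
(`range κ = ker P ≤ Sel`) and `ι_* c = res_⊤ y₀` splits as `ι_* c + ι′_* 0`. [cite: GreenbergLNM1716, §2] [cite: Agboola2007, §3] -/
theorem comap_kummer_le_ker_resOfLe_of_sel
    (hSel : ∀ y₀ ∈ V.selmerGroupPInfty p,
      ∀ (c : subgroupH1 (⊤ : Subgroup (absoluteGaloisGroup K)) ↥(V.endEigenPrimaryTorsion p π r))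
        (c' : subgroupH1 (⊤ : Subgroup (absoluteGaloisGroup K)) ↥(V.endEigenPrimaryTorsion p π (1 - r))),
        resH1Hom (ContinuousMonoidHom.id _) (V.endEigenPrimaryTorsion p π r).subtype (fun _ _ ↦ rfl) c +
            resH1Hom (ContinuousMonoidHom.id _) (V.endEigenPrimaryTorsion p π (1 - r)).subtype (fun _ _ ↦ rfl) c' =
          resSubgroup (⊤ : Subgroup (absoluteGaloisGroup K)) (V.geomPrimaryTorsion p) y₀ →
        Literature.NumberTheory.EllipticCurves.resOfLe ↥(V.endEigenPrimaryTorsion p π r) (inf_le_left : ⊤ ⊓ decomp v ≤ ⊤) c = 0) :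
    (((V.kummerMapPInfty p V.zsmul_geomPoints_surjective_holds).range).map
          (resSubgroup ⊤ (V.geomPrimaryTorsion p))).comap
        (resH1Hom (ContinuousMonoidHom.id _) (V.endEigenPrimaryTorsion p π r).subtype (fun _ _ ↦ rfl)) ≤
      (Literature.NumberTheory.EllipticCurves.resOfLe ↥(V.endEigenPrimaryTorsion p π r) (inf_le_left : ⊤ ⊓ decomp v ≤ ⊤)).ker := by
  intro c hc
  obtain ⟨y₀, hy₀, hy⟩ := AddSubgroup.mem_map.mp (AddSubgroup.mem_comap.mp hc)
  have hsel : y₀ ∈ V.selmerGroupPInfty p := by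
    rw [V.range_kummerMapPInfty p] at hy₀
    exact V.ker_primaryH1ToH1_le_selmerGroupPInfty p hy₀
  exact hSel y₀ hsel c 0 (by rw [map_zero, add_zero]; exact hy.symm)

omit [V.IsElliptic] in
/-- **(H1-Sel) ⟸ (H1″)**: given a decomposition `ι_* c + ι′_* c′ = res_⊤ y₀` of a Selmer class, `c = e_*(res_⊤ y₀)` for the
eigen-projector `e` (`e ∘ ι = id`, `e ∘ ι′ = 0`), and `ι_* e_* res_⊤ y₀ ∈ res_⊤ Sel` (-w7 g2 `resH1Hom_subtype_proj_mem_map_resSubgroup_selmer`: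
`π_*` preserves `Sel`) is classical at `v`, so (H1″) applies to it. [cite: Rubin1999, §2] [cite: Agboola2007, §6] -/
theorem sel_input_of_H1
    (hinf : V.endEigenPrimaryTorsion p π r ⊓ V.endEigenPrimaryTorsion p π (1 - r) = ⊥)
    (hsup : V.endEigenPrimaryTorsion p π r ⊔ V.endEigenPrimaryTorsion p π (1 - r) = ⊤) (hunit : IsUnit (r - (1 - r)))
    (φ : WeierstrassCurve.Isogeny V V) (hφ : ∀ P, φ P = (π : AddMonoid.End V.geomPoints) P)
    (hH1 : (V.localKerOver p ⊤ (v.adicCompletion K)).comap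
        (resH1Hom (ContinuousMonoidHom.id _) (V.endEigenPrimaryTorsion p π r).subtype (fun _ _ ↦ rfl)) ≤
      (Literature.NumberTheory.EllipticCurves.resOfLe ↥(V.endEigenPrimaryTorsion p π r) (inf_le_left : ⊤ ⊓ decomp v ≤ ⊤)).ker) :
    ∀ y₀ ∈ V.selmerGroupPInfty p,
      ∀ (c : subgroupH1 (⊤ : Subgroup (absoluteGaloisGroup K)) ↥(V.endEigenPrimaryTorsion p π r))
        (c' : subgroupH1 (⊤ : Subgroup (absoluteGaloisGroup K)) ↥(V.endEigenPrimaryTorsion p π (1 - r))),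
        resH1Hom (ContinuousMonoidHom.id _) (V.endEigenPrimaryTorsion p π r).subtype (fun _ _ ↦ rfl) c +
            resH1Hom (ContinuousMonoidHom.id _) (V.endEigenPrimaryTorsion p π (1 - r)).subtype (fun _ _ ↦ rfl) c' =
          resSubgroup (⊤ : Subgroup (absoluteGaloisGroup K)) (V.geomPrimaryTorsion p) y₀ →
        Literature.NumberTheory.EllipticCurves.resOfLe ↥(V.endEigenPrimaryTorsion p π r) (inf_le_left : ⊤ ⊓ decomp v ≤ ⊤) c = 0 := by
  intro y₀ hy₀ c c' hdec
  -- projectors; uniqueness of the decomposition gives `c = e_* (res_⊤ y₀)`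
  obtain ⟨e, he₁, he₂, hesub, he⟩ := exists_eigenProjector V p π r (1 - r) hinf hsup
  obtain ⟨e', he'₁, he'₂, -, he'⟩ := exists_eigenProjector V p π (1 - r) r (by rw [inf_comm]; exact hinf) (by rw [sup_comm]; exact hsup)
  have hsum := coe_proj_add_coe_proj V p π r (1 - r) e e' hesub he'₁ he'₂
  have hfr : ∀ (k : ℕ) (N : ℤ) (x : V.geomPrimaryTorsion p), x ∈ V.endEigenPrimaryTorsion p π r → p ^ k • x = 0 →
      ((N : ℤ_[p]) - r) ∈ (Ideal.span {(p : ℤ_[p]) ^ k} : Ideal ℤ_[p]) →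
        φ.toAddMonoidHom (x : V.geomPoints) = N • (x : V.geomPoints) := fun k N x hx hk hN ↦ by
    rw [show φ.toAddMonoidHom (x : V.geomPoints) = φ (x : V.geomPoints) from rfl, hφ]
    exact (eigen_of_endRing V p π r).2 k N x hx hk hN
  have hfr' : ∀ (k : ℕ) (N : ℤ) (x : V.geomPrimaryTorsion p), x ∈ V.endEigenPrimaryTorsion p π (1 - r) → p ^ k • x = 0 →
      ((N : ℤ_[p]) - (1 - r)) ∈ (Ideal.span {(p : ℤ_[p]) ^ k} : Ideal ℤ_[p]) →
        φ.toAddMonoidHom (x : V.geomPoints) = N • (x : V.geomPoints) := fun k N x hx hk hN ↦ by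
    rw [show φ.toAddMonoidHom (x : V.geomPoints) = φ (x : V.geomPoints) from rfl, hφ]
    exact (eigen_of_endRing V p π (1 - r)).2 k N x hx hk hN
  -- `ι_* e_* res_⊤ y₀ ∈ res_⊤ Sel`, hence classical at `v`
  have hselmem := resH1Hom_subtype_proj_mem_map_resSubgroup_selmer V p π r (1 - r) φ.toAddMonoidHom φ.equivariant hfr hfr' hunit
    φ.hasLocalPointsMaps_toAddMonoidHom e e' he he' hsum hy₀
  set c₀ := resH1Hom (ContinuousMonoidHom.id _) e (fun σ x ↦ by rw [Subgroup.smul_def, Subgroup.smul_def]; exact he σ x)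
    (resSubgroup (⊤ : Subgroup (absoluteGaloisGroup K)) (V.geomPrimaryTorsion p) y₀) with hc₀def
  have hclass : resH1Hom (ContinuousMonoidHom.id _) (V.endEigenPrimaryTorsion p π r).subtype (fun _ _ ↦ rfl) c₀ ∈
      V.localKerOver p ⊤ (v.adicCompletion K) := by
    obtain ⟨z, hz, hzc⟩ := AddSubgroup.mem_map.mp hselmem
    rw [← hzc]
    simp only [WeierstrassCurve.selmerGroupPInfty, AddSubgroup.mem_inf, AddSubgroup.mem_iInf] at hz
    exact V.resSubgroup_top_mem_localKerOver (hz.1 v)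
  have hc₀ : Literature.NumberTheory.EllipticCurves.resOfLe ↥(V.endEigenPrimaryTorsion p π r) (inf_le_left : ⊤ ⊓ decomp v ≤ ⊤) c₀ = 0 :=
    AddMonoidHom.mem_ker.mp (hH1 (AddSubgroup.mem_comap.mpr hclass))
  -- `c = c₀`: apply `e_*` to both decompositions (`e ∘ ι = id`, `e ∘ ι′ = 0`)
  have hsplit := resH1Hom_subtype_proj_add_eq V p π r (1 - r) ⊤ e e' he he' hsum
    (resSubgroup (⊤ : Subgroup (absoluteGaloisGroup K)) (V.geomPrimaryTorsion p) y₀)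
  have hproj : ∀ (a : subgroupH1 (⊤ : Subgroup (absoluteGaloisGroup K)) ↥(V.endEigenPrimaryTorsion p π r))
      (b : subgroupH1 (⊤ : Subgroup (absoluteGaloisGroup K)) ↥(V.endEigenPrimaryTorsion p π (1 - r))),
      resH1Hom (ContinuousMonoidHom.id _) e (fun σ x ↦ by rw [Subgroup.smul_def, Subgroup.smul_def]; exact he σ x)
        (resH1Hom (ContinuousMonoidHom.id _) (V.endEigenPrimaryTorsion p π r).subtype (fun _ _ ↦ rfl) a +
          resH1Hom (ContinuousMonoidHom.id _) (V.endEigenPrimaryTorsion p π (1 - r)).subtype (fun _ _ ↦ rfl) b) = a := by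
    intro a b
    have k1 : (resH1Hom (ContinuousMonoidHom.id (⊤ : Subgroup (absoluteGaloisGroup K))) e
        (fun σ x ↦ by rw [Subgroup.smul_def, Subgroup.smul_def]; exact he σ x)).comp
        (resH1Hom (ContinuousMonoidHom.id _) (V.endEigenPrimaryTorsion p π r).subtype (fun _ _ ↦ rfl)) = AddMonoidHom.id _ := by
      rw [resH1Hom_comp, ← resH1Hom_id]
      exact resH1Hom_congr (ContinuousMonoidHom.ext fun _ ↦ rfl) (AddMonoidHom.ext fun x ↦ he₁ x) _ _
    have k2 : ∀ b' : subgroupH1 (⊤ : Subgroup (absoluteGaloisGroup K)) ↥(V.endEigenPrimaryTorsion p π (1 - r)),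
        resH1Hom (ContinuousMonoidHom.id (⊤ : Subgroup (absoluteGaloisGroup K))) e
          (fun σ x ↦ by rw [Subgroup.smul_def, Subgroup.smul_def]; exact he σ x)
          (resH1Hom (ContinuousMonoidHom.id _) (V.endEigenPrimaryTorsion p π (1 - r)).subtype (fun _ _ ↦ rfl) b') = 0 := by
      intro b'
      obtain ⟨a', rfl⟩ := oneCocycleClass_surjective _ b'
      rw [Literature.NumberTheory.EllipticCurves.resH1Hom_id_oneCocycleClass,
        Literature.NumberTheory.EllipticCurves.resH1Hom_id_oneCocycleClass]
      refine (oneCocycleClass_eq_zero_iff _ _).mpr ⟨0, fun g ↦ ?_⟩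
      simp only [map_zero, sub_zero]
      exact he₂ _ (a'.1 g).2
    have h1 := congrArg (fun F ↦ F a) k1
    have h2 := k2 b
    simp only [AddMonoidHom.comp_apply, AddMonoidHom.id_apply] at h1
    rw [map_add, h1, h2, add_zero]
  have hcc : c = c₀ := by
    have h := hproj c c'
    rw [hdec] at h
    rw [← h]
  rw [hcc]
  exact hc₀

end Generic

end Summit.BirchSwinnertonDyer.BirchSwinnertonDyer.Theorems.PrintCf2.CMPrimes

end
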